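import Literature.NumberTheory.LFunctions.ZetaScrew
import Literature.NumberTheory.LFunctions.ZetaScrewLaplace
import Literature.NumberTheory.LFunctions.EquivalentsKeiperLiProofs
import Mathlib.Analysis.Fourier.Inversion
import Mathlib.Analysis.SpecialFunctions.ImproperIntegrals
import Mathlib.MeasureTheory.Integral.DominatedConvergence
import HarnessLib

/-!
# Suzuki's Theorem 1.1 (2) (the series over the zeros) from Theorem 1.1 (1): proofs

Second sibling proofs file (D-0014 append protocol) of
`Literature/NumberTheory/LFunctions/ZetaScrew.lean` (the first, `ZetaScrewProofs.lean`, deduces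
Thm 1.2 from Thm 1.1 (1), (2)).

M. Suzuki, *Aspects of the screw function corresponding to the Riemann zeta-function*,
J. Lond. Math. Soc. (2) 108 (2023) 1448–1487 = arXiv:2206.03682 [Suzuki2023], Theorem 1.1 (2):
for every real `t`,

  `Ψ(t) = ∑_γ (1 − cos γt)/γ²`  (zeros `γ` of `ξ(1/2 − iz)` with multiplicity),

i.e. in the variable `ρ = ½ − iγ` the named fact `Suzuki2023_thm11_series` of `ZetaScrew.lean`:
`HasSum (ρ ↦ m(ρ) (cosh((ρ − ½)t) − 1)/(ρ − ½)²) Ψ(t)` over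
`ZetaZeros.riemannZetaNontrivialZeros`, `m(ρ) = riemannZetaZeroOrder ρ`.  We prove it GRANTING
Thm 1.1 (1) (the named fact `Suzuki2023_thm11_fourier`, the one-sided Fourier transform formula
(1.2)), exactly as in Suzuki2023 §2.2:

* **Part I** (Hadamard product and termwise Laplace transforms).  Suzuki: "Since `ξ(s)` is an
  order one entire function, Hadamard's factorization theorem gives … (2.6)
  `(ξ'/ξ)(1/2 − iz) = ib + i∑_γ (1/(z−γ) + 1/γ)` … For each term
  `−(i/z²)(1/(z−γ) + 1/γ) = ∫₀^∞ (1 − e^{−itγ})/γ² e^{izt} dt`, `Im z > Im γ`".  We use the tree's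
  grouped Hadamard product of `ξ` (`Literature.NumberTheory.LFunctions.IsHadamardSeq`,
  `RiemannXiHadamardProduct.lean`: for a Hadamard sequence `b` of de Bruijn's `H₀`,
  `ξ'/ξ(s) = ∑ₙ [1/(s − ρₙ) + 1/(s − (1 − ρₙ))]`, `ρₙ = xiZero b n`, pairs `{ρₙ, 1 − ρₙ}` ↔
  `{γ, −γ}`, so that the constant `b` of (2.6) and the terms `1/γ` are absorbed by the pairing):
  the pair term `Pₙ(t) = 8bₙ(cosh((ρₙ − ½)t) − 1) = 2(cosh(wt) − 1)/w²` (`w = ρₙ − ½ = −iγ`,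
  `w² = 1/(4bₙ)`) has `‖Pₙ(t)‖ ≤ 8‖bₙ‖(cosh(t/2) + 1)` (`|Re w| < ½`), the pair series
  `Ψ̃ = ∑ₙ Pₙ` converges absolutely and locally uniformly, and for `Im z > ½`
  `∫₀^∞ Pₙ e^{izt} = −z⁻²[1/(s − ρₙ) + 1/(s − (1 − ρₙ))]` (`s = ½ − iz`; three exponential
  integrals), whence, summing under the integral sign,
  `∫₀^∞ Ψ̃ e^{izt} = −z⁻² ξ'/ξ(½ − iz) = ∫₀^∞ Ψ e^{izt}` by (1.2).
* **Part II** (uniqueness).  Suzuki: "The two functions `Ψ(t)` and `Ψ̃(t)` have the same Fourier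
  transform, so they are identical": `eq_zero_of_laplace_eq_zero`, by Mathlib's Fourier inversion
  theorem applied to the continuous integrable function `𝟙_{[0,∞)}(Ψ − Ψ̃)e^{−y₀t}` whose
  Fourier transform vanishes identically.
* **Part III** (multiplicities).  The Hadamard indices list the pairs of zeros with multiplicity:
  at a non-trivial zero `ρ` exactly `m(ρ)` factors vanish
  (`IsHadamardSeq.natCast_card_zeroIndices_xiToH`, `EquivalentsKeiperLiProofs.lean`), so the pair
  sum regroups as the sum over `ZetaZeros.riemannZetaNontrivialZeros` weighted by `m(ρ)`
  (`IsHadamardSeq.hasSum_nontrivialZeros_of_hasSum_pairs`; `HasSum.sigma` over the fibres of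
  `(n, ±) ↦ ρₙ, 1 − ρₙ`).
* **Part IV**: `IsHadamardSeq.zetaScrew_eq_tsum_pairTerm` (`Ψ = Ψ̃`) and
  `Suzuki2023_thm11_series_of_fourier : Suzuki2023_thm11_fourier → Suzuki2023_thm11_series`.
* **Part V** (unconditional discharge): Thm 1.1 (1) is a theorem of the tree
  (`Suzuki2023_thm11_fourier_holds`, `ZetaScrewLaplace.lean`), whence
  `Suzuki2023_thm11_series_holds : Suzuki2023_thm11_series`.

## References

* M. Suzuki, J. Lond. Math. Soc. (2) 108 (2023), no. 4, 1448–1487; arXiv:2206.03682, Thm 1.1 and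
  §2.2. [Suzuki2023]
* D. H. J. Polymath, Res. Math. Sci. 6 (2019), §3 (grouped Hadamard product of `H_t`).
  [Polymath2019]
-/

noncomputable section

open Complex Filter Topology Set MeasureTheory Asymptotics
open scoped Real ComplexConjugate BigOperators FourierTransform

namespace Literature.NumberTheory.LFunctions

/-! ## Part I. The series over the Hadamard pairs and its Laplace transform -/

namespace IsHadamardSeq

variable {b : ℕ → ℂ}

/-- For a genuine Hadamard index (`bₙ ≠ 0`), `|Re(ρₙ − ½)| < ½` (the zeros of `ξ` lie in the open
critical strip). [folklore] -/
theorem abs_re_xiZero_sub_half_lt (h : IsHadamardSeq 0 b) {n : ℕ} (hn : b n ≠ 0) :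
    |(xiZero b n - 1 / 2).re| < 1 / 2 := by
  obtain ⟨-, h0, h1, -⟩ := riemannXi_zero_prop (h.riemannXi_xiZero hn)
  rw [abs_lt, sub_re]
  norm_num
  constructor <;> linarith

/-- **The pair term.** `Pₙ(t) = 8bₙ (cosh((ρₙ − ½)t) − 1)` (`= 2(cosh(wt) − 1)/w²`, `w = ρₙ − ½`,
`w² = 1/(4bₙ)`; it is `(1 − cos γt)/γ² + (1 − cos(−γ)t)/γ²` for the pair `±γ`, `γ = i(ρₙ − ½)`, of
zeros of `ξ(1/2 − iz)`) satisfies `‖Pₙ(t)‖ ≤ 8‖bₙ‖ (cosh(t/2) + 1)`. [cite: Suzuki2023, §2.2] -/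
theorem norm_pairTerm_le (h : IsHadamardSeq 0 b) (n : ℕ) (t : ℝ) :
    ‖8 * b n * (Complex.cosh ((xiZero b n - 1 / 2) * t) - 1)‖ ≤
      8 * ‖b n‖ * (Real.cosh (t / 2) + 1) := by
  by_cases hn : b n = 0
  · simp only [hn, mul_zero, zero_mul, norm_zero]
    positivity
  have hw := h.abs_re_xiZero_sub_half_lt hn
  -- `‖cosh z‖ ≤ cosh (Re z)` (also `Literature.Barriers.RiemannHypothesis.norm_ccosh_le_cosh_re`,
  -- not imported here)
  have hcosh : ∀ z : ℂ, ‖Complex.cosh z‖ ≤ Real.cosh z.re := by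
    intro z
    rw [Complex.cosh, Real.cosh_eq, norm_div, Complex.norm_ofNat]
    gcongr
    calc ‖Complex.exp z + Complex.exp (-z)‖
        ≤ ‖Complex.exp z‖ + ‖Complex.exp (-z)‖ := norm_add_le _ _
      _ = Real.exp z.re + Real.exp (-z.re) := by rw [Complex.norm_exp, Complex.norm_exp, neg_re]
  rw [norm_mul, norm_mul, Complex.norm_ofNat]
  gcongr
  calc ‖Complex.cosh ((xiZero b n - 1 / 2) * t) - 1‖
      ≤ ‖Complex.cosh ((xiZero b n - 1 / 2) * t)‖ + ‖(1 : ℂ)‖ := norm_sub_le _ _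
    _ ≤ Real.cosh (((xiZero b n - 1 / 2) * t).re) + 1 := by
        rw [norm_one]
        gcongr
        exact hcosh _
    _ ≤ Real.cosh (t / 2) + 1 := by
        gcongr ?_ + 1
        rw [Real.cosh_le_cosh, mul_re, ofReal_re, ofReal_im, mul_zero, sub_zero, abs_mul, abs_div,
          abs_two]
        have ht : 0 ≤ |t| := abs_nonneg t
        nlinarith

/-- The pair terms are absolutely summable, uniformly for `|t| ≤ T`. [folklore] -/
theorem summable_norm_pairTerm (h : IsHadamardSeq 0 b) (t : ℝ) :
    Summable fun n ↦ ‖8 * b n * (Complex.cosh ((xiZero b n - 1 / 2) * t) - 1)‖ :=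
  ((h.summable.mul_left 8).mul_right (Real.cosh (t / 2) + 1)).of_nonneg_of_le
    (fun _ ↦ norm_nonneg _) (fun n ↦ h.norm_pairTerm_le n t)

/-- The pair series `Ψ̃(t) = ∑ₙ Pₙ(t)` converges absolutely. [folklore] -/
theorem summable_pairTerm (h : IsHadamardSeq 0 b) (t : ℝ) :
    Summable fun n ↦ 8 * b n * (Complex.cosh ((xiZero b n - 1 / 2) * t) - 1) :=
  (h.summable_norm_pairTerm t).of_norm

/-- `Ψ̃` is continuous (locally uniform convergence). [folklore] -/
theorem continuous_tsum_pairTerm (h : IsHadamardSeq 0 b) :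
    Continuous fun t : ℝ ↦ ∑' n, 8 * b n * (Complex.cosh ((xiZero b n - 1 / 2) * t) - 1) := by
  refine continuous_iff_continuousAt.2 fun t₀ ↦ ?_
  set T : ℝ := |t₀| + 1 with hT
  have hopen : IsOpen {t : ℝ | |t| < T} := isOpen_lt continuous_abs continuous_const
  have hmem : t₀ ∈ {t : ℝ | |t| < T} := by simp [hT]
  have hcont : ContinuousOn
      (fun t : ℝ ↦ ∑' n, 8 * b n * (Complex.cosh ((xiZero b n - 1 / 2) * t) - 1))
      {t : ℝ | |t| < T} := by
    refine continuousOn_tsum (fun n ↦ ?_) ((h.summable.mul_left 8).mul_right (Real.cosh (T / 2) + 1))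
      (fun n t ht ↦ ?_)
    · exact (continuous_const.mul ((Complex.continuous_cosh.comp
        (continuous_const.mul Complex.continuous_ofReal)).sub continuous_const)).continuousOn
    · have ht : |t| < T := ht
      refine (h.norm_pairTerm_le n t).trans ?_
      gcongr
      rw [Real.cosh_le_cosh, abs_div, abs_div, abs_two]
      have : |T| = T := abs_of_pos (by rw [hT]; positivity)
      rw [this]
      linarith
  exact hcont.continuousAt (hopen.mem_nhds hmem)

/-- `Ψ̃` is even. [folklore] -/
theorem tsum_pairTerm_neg (t : ℝ) :
    (∑' n, 8 * b n * (Complex.cosh ((xiZero b n - 1 / 2) * ((-t : ℝ) : ℂ)) - 1)) =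
      ∑' n, 8 * b n * (Complex.cosh ((xiZero b n - 1 / 2) * t) - 1) := by
  refine tsum_congr fun n ↦ ?_
  rw [ofReal_neg, mul_neg, Complex.cosh_neg]

/-- `Ψ̃(0) = 0`. [folklore] -/
theorem tsum_pairTerm_zero :
    (∑' n, 8 * b n * (Complex.cosh ((xiZero b n - 1 / 2) * ((0 : ℝ) : ℂ)) - 1)) = 0 := by
  simp

/-- `|Ψ̃(t)| ≤ 8 (∑‖bₙ‖)(cosh(t/2) + 1)`. [folklore] -/
theorem norm_tsum_pairTerm_le (h : IsHadamardSeq 0 b) (t : ℝ) :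
    ‖∑' n, 8 * b n * (Complex.cosh ((xiZero b n - 1 / 2) * t) - 1)‖ ≤
      8 * (∑' n, ‖b n‖) * (Real.cosh (t / 2) + 1) := by
  refine (norm_tsum_le_tsum_norm (h.summable_norm_pairTerm t)).trans ?_
  rw [← tsum_mul_left, ← tsum_mul_right]
  exact (h.summable_norm_pairTerm t).tsum_le_tsum (fun n ↦ h.norm_pairTerm_le n t)
    ((h.summable.mul_left 8).mul_right _)

/-! ### Laplace transforms -/

/-- `‖e^{izt}‖ = e^{−(Im z) t}` for real `t`. [folklore] -/
theorem norm_exp_I_mul_mul (z : ℂ) (t : ℝ) :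
    ‖Complex.exp (I * z * t)‖ = Real.exp (-z.im * t) := by
  rw [Complex.norm_exp]
  congr 1
  simp [Complex.mul_re, Complex.mul_im]

/-- `Pₙ(t) e^{izt}` as a combination of three exponentials. [folklore] -/
theorem pairTerm_mul_exp (c w z : ℂ) (t : ℝ) :
    c * (Complex.cosh (w * t) - 1) * Complex.exp (I * z * t) =
      c * ((1 / 2) * Complex.exp ((w + I * z) * t) + (1 / 2) * Complex.exp ((-w + I * z) * t)
        - Complex.exp ((I * z) * t)) := by
  rw [Complex.cosh, add_mul w, add_mul (-w), Complex.exp_add, Complex.exp_add, neg_mul]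
  ring

/-- `∫₀^∞ e^{at} dt = −1/a` for `Re a < 0`. [folklore] -/
theorem integral_exp_mul_Ioi_zero {a : ℂ} (ha : a.re < 0) :
    ∫ t in Ioi (0 : ℝ), Complex.exp (a * t) = -1 / a := by
  rw [integral_exp_mul_complex_Ioi ha 0]
  simp

/-- The `n`-th integrand `Pₙ(t) e^{izt}` is integrable on `(0, ∞)` for `Im z > 1/2`. [folklore] -/
theorem integrableOn_pairTerm_mul_exp (h : IsHadamardSeq 0 b) (n : ℕ) {z : ℂ} (hz : 1 / 2 < z.im) :
    IntegrableOn (fun t : ℝ ↦ 8 * b n * (Complex.cosh ((xiZero b n - 1 / 2) * t) - 1) *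
      Complex.exp (I * z * t)) (Ioi 0) := by
  by_cases hn : b n = 0
  · simp only [hn, mul_zero, zero_mul]
    exact integrableOn_zero
  set w := xiZero b n - 1 / 2 with hw_def
  have hw := h.abs_re_xiZero_sub_half_lt hn
  rw [← hw_def, abs_lt] at hw
  have h1 : (w + I * z).re < 0 := by simp; linarith
  have h2 : (-w + I * z).re < 0 := by simp; linarith
  have h3 : (I * z).re < 0 := by simp; linarith
  have e : (fun t : ℝ ↦ 8 * b n * (Complex.cosh (w * t) - 1) * Complex.exp (I * z * t)) =
      fun t : ℝ ↦ 8 * b n * ((1 / 2) * Complex.exp ((w + I * z) * t)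
        + (1 / 2) * Complex.exp ((-w + I * z) * t) - Complex.exp ((I * z) * t)) :=
    funext fun t ↦ pairTerm_mul_exp _ _ _ _
  rw [e]
  exact ((((integrableOn_exp_mul_complex_Ioi h1 0).const_mul _).add
    ((integrableOn_exp_mul_complex_Ioi h2 0).const_mul _)).sub
    (integrableOn_exp_mul_complex_Ioi h3 0)).const_mul _

/-- **Laplace transform of a pair term** (Suzuki2023 §2.2, "by direct calculation"): for
`Im z > 1/2` and `s = 1/2 − iz`,
`∫₀^∞ Pₙ(t) e^{izt} dt = −z⁻² [1/(s − ρₙ) + 1/(s − (1 − ρₙ))]`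
(and `0 = 0` for a padding index `bₙ = 0`). [cite: Suzuki2023, §2.2] -/
theorem integral_pairTerm_mul_exp (h : IsHadamardSeq 0 b) (n : ℕ) {z : ℂ} (hz : 1 / 2 < z.im) :
    ∫ t in Ioi (0 : ℝ), 8 * b n * (Complex.cosh ((xiZero b n - 1 / 2) * t) - 1) *
        Complex.exp (I * z * t) =
      -(1 / z ^ 2) * (if b n = 0 then 0 else
        1 / ((1 / 2 - I * z) - xiZero b n) + 1 / ((1 / 2 - I * z) - (1 - xiZero b n))) := by
  by_cases hn : b n = 0
  · simp [hn]
  simp only [hn, if_false]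
  set w := xiZero b n - 1 / 2 with hw_def
  have hw := h.abs_re_xiZero_sub_half_lt hn
  rw [← hw_def, abs_lt] at hw
  have h1 : (w + I * z).re < 0 := by simp; linarith
  have h2 : (-w + I * z).re < 0 := by simp; linarith
  have h3 : (I * z).re < 0 := by simp; linarith
  have e : (fun t : ℝ ↦ 8 * b n * (Complex.cosh (w * t) - 1) * Complex.exp (I * z * t)) =
      fun t : ℝ ↦ 8 * b n * ((1 / 2) * Complex.exp ((w + I * z) * t)
        + (1 / 2) * Complex.exp ((-w + I * z) * t) - Complex.exp ((I * z) * t)) :=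
    funext fun t ↦ pairTerm_mul_exp _ _ _ _
  rw [e, integral_const_mul, integral_sub, integral_add, integral_const_mul, integral_const_mul,
    integral_exp_mul_Ioi_zero h1, integral_exp_mul_Ioi_zero h2, integral_exp_mul_Ioi_zero h3]
  rotate_left
  · exact (integrableOn_exp_mul_complex_Ioi h1 0).const_mul _
  · exact (integrableOn_exp_mul_complex_Ioi h2 0).const_mul _
  · exact ((integrableOn_exp_mul_complex_Ioi h1 0).const_mul _).add
      ((integrableOn_exp_mul_complex_Ioi h2 0).const_mul _)
  · exact integrableOn_exp_mul_complex_Ioi h3 0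
  -- algebra
  have hA : w + I * z ≠ 0 := fun h0 ↦ by
    have := congrArg Complex.re h0; simp at this; linarith
  have hB : -w + I * z ≠ 0 := fun h0 ↦ by
    have := congrArg Complex.re h0; simp at this; linarith
  have hz0 : z ≠ 0 := by
    rintro rfl; simp at hz; linarith
  have hC : I * z ≠ 0 := mul_ne_zero I_ne_zero hz0
  have hxi : xiZero b n = w + 1 / 2 := by rw [hw_def]; ring
  have e1 : (1 / 2 - I * z) - xiZero b n = -(w + I * z) := by rw [hxi]; ring
  have e2 : (1 / 2 - I * z) - (1 - xiZero b n) = -(-w + I * z) := by rw [hxi]; ring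
  rw [e1, e2]
  have hsq : w ^ 2 = 1 / (4 * b n) := xiZero_sub_half_sq b n
  have hw0 : w ≠ 0 := by
    intro h0; rw [h0] at hsq; simp at hsq; exact hn (by simpa using hsq)
  have hb : b n = 1 / (4 * w ^ 2) := by rw [hsq]; field_simp
  rw [hb]
  field_simp
  ring_nf
  rw [I_sq]
  ring

/-- The norm integral of the `n`-th integrand is `≤ 16‖bₙ‖ ∫₀^∞ e^{−(Im z − 1/2)t} dt`. [folklore] -/
theorem integral_norm_pairTerm_mul_exp_le (h : IsHadamardSeq 0 b) (n : ℕ) {z : ℂ}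
    (hz : 1 / 2 < z.im) :
    ∫ t in Ioi (0 : ℝ), ‖8 * b n * (Complex.cosh ((xiZero b n - 1 / 2) * t) - 1) *
        Complex.exp (I * z * t)‖ ≤
      16 * ‖b n‖ * ∫ t in Ioi (0 : ℝ), Real.exp (-(z.im - 1 / 2) * t) := by
  rw [← integral_const_mul]
  refine setIntegral_mono_on (h.integrableOn_pairTerm_mul_exp n hz).norm
    ((exp_neg_integrableOn_Ioi 0 (by linarith : 0 < z.im - 1 / 2)).const_mul _)
    measurableSet_Ioi fun t ht ↦ ?_
  have ht : 0 < t := ht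
  rw [norm_mul, norm_exp_I_mul_mul]
  have hc : Real.cosh (t / 2) + 1 ≤ 2 * Real.exp (t / 2) := by
    rw [Real.cosh_eq]
    have e1 : Real.exp (-(t / 2)) ≤ Real.exp (t / 2) := Real.exp_le_exp.2 (by linarith)
    have e2 : 1 ≤ Real.exp (t / 2) := Real.one_le_exp (by linarith)
    linarith
  calc ‖8 * b n * (Complex.cosh ((xiZero b n - 1 / 2) * t) - 1)‖ * Real.exp (-z.im * t)
      ≤ 8 * ‖b n‖ * (Real.cosh (t / 2) + 1) * Real.exp (-z.im * t) := by
        gcongr; exact h.norm_pairTerm_le n t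
    _ ≤ 8 * ‖b n‖ * (2 * Real.exp (t / 2)) * Real.exp (-z.im * t) := by gcongr
    _ = 16 * ‖b n‖ * Real.exp (-(z.im - 1 / 2) * t) := by
        have : Real.exp (t / 2) * Real.exp (-z.im * t) = Real.exp (-(z.im - 1 / 2) * t) := by
          rw [← Real.exp_add]; ring_nf
        rw [← this]; ring

/-- **Termwise integration** ("interchanging summation and integration, which is justified by
the absolute convergence of the sum", Suzuki2023 §2.2): for `Im z > 1/2`,
`∑ₙ ∫₀^∞ Pₙ e^{izt} = ∫₀^∞ Ψ̃ e^{izt}`. [cite: Suzuki2023, §2.2] -/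
theorem hasSum_integral_pairTerm_mul_exp (h : IsHadamardSeq 0 b) {z : ℂ} (hz : 1 / 2 < z.im) :
    HasSum (fun n ↦ ∫ t in Ioi (0 : ℝ), 8 * b n * (Complex.cosh ((xiZero b n - 1 / 2) * t) - 1) *
        Complex.exp (I * z * t))
      (∫ t in Ioi (0 : ℝ), (∑' n, 8 * b n * (Complex.cosh ((xiZero b n - 1 / 2) * t) - 1)) *
        Complex.exp (I * z * t)) := by
  have key := hasSum_integral_of_summable_integral_norm (μ := volume.restrict (Ioi (0 : ℝ)))
    (F := fun (n : ℕ) (t : ℝ) ↦ 8 * b n * (Complex.cosh ((xiZero b n - 1 / 2) * t) - 1) *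
      Complex.exp (I * z * t))
    (fun n ↦ h.integrableOn_pairTerm_mul_exp n hz) ?_
  · have e : (fun t : ℝ ↦ ∑' n, 8 * b n * (Complex.cosh ((xiZero b n - 1 / 2) * t) - 1) *
        Complex.exp (I * z * t)) =
        fun t : ℝ ↦ (∑' n, 8 * b n * (Complex.cosh ((xiZero b n - 1 / 2) * t) - 1)) *
          Complex.exp (I * z * t) :=
      funext fun t ↦ tsum_mul_right
    rw [e] at key
    exact key
  · refine Summable.of_nonneg_of_le (fun n ↦ integral_nonneg fun t ↦ norm_nonneg _)
      (fun n ↦ h.integral_norm_pairTerm_mul_exp_le n hz) ?_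
    exact (h.summable.mul_left 16).mul_right _

/-- **Laplace transform of the pair series**: for `Im z > 1/2`,
`∫₀^∞ Ψ̃(t) e^{izt} dt = −z⁻² (ξ'/ξ)(1/2 − iz)`, by the partial-fraction series
`ξ'/ξ(s) = ∑ₙ [1/(s−ρₙ) + 1/(s−(1−ρₙ))]` of the tree's Hadamard product
(`IsHadamardSeq.logDeriv_riemannXi_eq_tsum_pairs`; Suzuki2023 (2.6) with `b = 0` absorbed by the
pairing `γ ↔ −γ`). [cite: Suzuki2023, §2.2] -/
theorem integral_tsum_pairTerm_mul_exp (h : IsHadamardSeq 0 b) {z : ℂ} (hz : 1 / 2 < z.im) :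
    ∫ t in Ioi (0 : ℝ), (∑' n, 8 * b n * (Complex.cosh ((xiZero b n - 1 / 2) * t) - 1)) *
        Complex.exp (I * z * t) =
      -(1 / z ^ 2) * (deriv riemannXi (1 / 2 - I * z) / riemannXi (1 / 2 - I * z)) := by
  set s : ℂ := 1 / 2 - I * z with hs_def
  have hs : 1 < s.re := by
    simp only [hs_def, sub_re, mul_re, I_re, I_im, zero_mul, one_mul, zero_sub]
    norm_num
    linarith
  have hξ : riemannXi s ≠ 0 := fun h0 ↦ by
    have := ((riemannXi_eq_zero_iff_holds s).1 h0).2.2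
    linarith
  have h1 := h.hasSum_integral_pairTerm_mul_exp hz
  have h2 : HasSum (fun n ↦ -(1 / z ^ 2) * (if b n = 0 then 0 else
      1 / (s - xiZero b n) + 1 / (s - (1 - xiZero b n)))) (-(1 / z ^ 2) * logDeriv riemannXi s) := by
    rw [h.logDeriv_riemannXi_eq_tsum_pairs hξ]
    exact (h.summable_pairs hξ).hasSum.mul_left _
  have h3 : (fun n ↦ ∫ t in Ioi (0 : ℝ), 8 * b n * (Complex.cosh ((xiZero b n - 1 / 2) * t) - 1) *
      Complex.exp (I * z * t)) = fun n ↦ -(1 / z ^ 2) * (if b n = 0 then 0 else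
        1 / (s - xiZero b n) + 1 / (s - (1 - xiZero b n))) :=
    funext fun n ↦ h.integral_pairTerm_mul_exp n hz
  rw [h3] at h1
  rw [h1.unique h2, logDeriv_apply]

/-- The pair series times `e^{izt}` is integrable on `(0,∞)` for `Im z > 1/2`
(`|Ψ̃(t)| ≤ 8(∑‖bₙ‖)(cosh(t/2)+1)`). [folklore] -/
theorem integrableOn_tsum_pairTerm_mul_exp (h : IsHadamardSeq 0 b) {z : ℂ} (hz : 1 / 2 < z.im) :
    IntegrableOn (fun t : ℝ ↦ (∑' n, 8 * b n * (Complex.cosh ((xiZero b n - 1 / 2) * t) - 1)) *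
      Complex.exp (I * z * t)) (Ioi 0) := by
  set B : ℝ := ∑' n, ‖b n‖ with hB
  have hB0 : 0 ≤ B := tsum_nonneg fun n ↦ norm_nonneg _
  have hcont : Continuous fun t : ℝ ↦
      (∑' n, 8 * b n * (Complex.cosh ((xiZero b n - 1 / 2) * t) - 1)) * Complex.exp (I * z * t) :=
    h.continuous_tsum_pairTerm.mul
      (Complex.continuous_exp.comp (continuous_const.mul Complex.continuous_ofReal))
  refine Integrable.mono' ((exp_neg_integrableOn_Ioi 0 (by linarith : 0 < z.im - 1 / 2)).const_mul
    (16 * B)) hcont.aestronglyMeasurable ?_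
  refine (ae_restrict_iff' measurableSet_Ioi).2 (Filter.Eventually.of_forall fun t ht ↦ ?_)
  have ht : 0 < t := ht
  rw [norm_mul, norm_exp_I_mul_mul]
  have hc : Real.cosh (t / 2) + 1 ≤ 2 * Real.exp (t / 2) := by
    rw [Real.cosh_eq]
    have e1 : Real.exp (-(t / 2)) ≤ Real.exp (t / 2) := Real.exp_le_exp.2 (by linarith)
    have e2 : 1 ≤ Real.exp (t / 2) := Real.one_le_exp (by linarith)
    linarith
  calc ‖∑' n, 8 * b n * (Complex.cosh ((xiZero b n - 1 / 2) * t) - 1)‖ * Real.exp (-z.im * t)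
      ≤ 8 * B * (Real.cosh (t / 2) + 1) * Real.exp (-z.im * t) := by
        gcongr; exact h.norm_tsum_pairTerm_le t
    _ ≤ 8 * B * (2 * Real.exp (t / 2)) * Real.exp (-z.im * t) := by gcongr
    _ = 16 * B * Real.exp (-(z.im - 1 / 2) * t) := by
        have : Real.exp (t / 2) * Real.exp (-z.im * t) = Real.exp (-(z.im - 1 / 2) * t) := by
          rw [← Real.exp_add]; ring_nf
        rw [← this]; ring

/-- **Same Laplace transform.** Granting Thm 1.1 (1) (`Suzuki2023_thm11_fourier`), `Ψ` and the
pair series `Ψ̃` have the same one-sided Fourier–Laplace transform on `Im z > 1/2`: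
`∫₀^∞ (Ψ − Ψ̃)(t) e^{izt} dt = 0` ("the two functions `Ψ(t)` and `Ψ̃(t)` have the same Fourier
transform", Suzuki2023 §2.2). [cite: Suzuki2023, §2.2] -/
theorem integral_zetaScrew_sub_tsum_pairTerm_mul_exp (h : IsHadamardSeq 0 b)
    (h1 : Suzuki2023_thm11_fourier) {z : ℂ} (hz : 1 / 2 < z.im) :
    ∫ t in Ioi (0 : ℝ), ((zetaScrew t : ℂ) -
        ∑' n, 8 * b n * (Complex.cosh ((xiZero b n - 1 / 2) * t) - 1)) *
      Complex.exp (I * z * t) = 0 := by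
  obtain ⟨hint, hval⟩ := h1 z hz
  have e : ∀ t : ℝ, ((zetaScrew t : ℂ) -
        ∑' n, 8 * b n * (Complex.cosh ((xiZero b n - 1 / 2) * t) - 1)) * Complex.exp (I * z * t) =
      (zetaScrew t : ℂ) * Complex.exp (I * z * t) -
        (∑' n, 8 * b n * (Complex.cosh ((xiZero b n - 1 / 2) * t) - 1)) *
          Complex.exp (I * z * t) := fun t ↦ sub_mul _ _ _
  simp only [e]
  rw [integral_sub hint (h.integrableOn_tsum_pairTerm_mul_exp hz), hval,
    h.integral_tsum_pairTerm_mul_exp hz, sub_self]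

end IsHadamardSeq

/-! ## Part II. Uniqueness of the one-sided Fourier–Laplace transform

"The two functions `Ψ(t)` and `Ψ̃(t)` have the same Fourier transform, so they are identical"
(Suzuki2023 §2.2): a continuous `D` on `[0, ∞)` with `D(0) = 0`, `D e^{−y₀t}` integrable and
`∫₀^∞ D(t) e^{izt} dt = 0` on the line `Im z = y₀` vanishes — Fourier inversion (Mathlib's
`MeasureTheory.Integrable.fourierInv_fourier_eq`) for the continuous integrable function
`F = 𝟙_{[0,∞)} D e^{−y₀ t}`, whose Fourier transform `𝓕F(x) = ∫₀^∞ D e^{i(−2πx + iy₀)t} dt`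
vanishes identically. -/

/-- **Uniqueness of the Laplace transform along a horizontal line.** [folklore] -/
theorem eq_zero_of_laplace_eq_zero {D : ℝ → ℂ} {y₀ : ℝ} (hcont : ContinuousOn D (Ici 0))
    (h0 : D 0 = 0)
    (hint : IntegrableOn (fun t : ℝ ↦ D t * Complex.exp (I * ((y₀ : ℂ) * I) * t)) (Ioi 0))
    (hL : ∀ x : ℝ, ∫ t in Ioi (0 : ℝ), D t * Complex.exp (I * ((x : ℂ) + y₀ * I) * t) = 0)
    {t : ℝ} (ht : 0 ≤ t) : D t = 0 := by
  classical
  -- the function `F = 𝟙_{[0,∞)} D e^{-y₀ t}`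
  set G : ℝ → ℂ := fun t ↦ D t * Complex.exp (I * ((y₀ : ℂ) * I) * t) with hG
  set F : ℝ → ℂ := (Ici (0 : ℝ)).indicator G with hF
  have hGcont : ContinuousOn G (Ici 0) :=
    hcont.mul (Complex.continuous_exp.comp (continuous_const.mul Complex.continuous_ofReal)).continuousOn
  have hFcont : Continuous F := by
    rw [hF, ← Set.piecewise_eq_indicator]
    refine continuous_piecewise (fun a ha ↦ ?_) (by rwa [closure_Ici]) ?_
    · rw [frontier_Ici] at ha
      rw [Set.mem_singleton_iff.1 ha]
      simp [hG, h0]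
    · exact continuousOn_const
  have hFint : Integrable F := by
    rw [hF, integrable_indicator_iff measurableSet_Ici]
    exact (integrableOn_Ici_iff_integrableOn_Ioi (by finiteness)).2 hint
  -- its Fourier transform vanishes
  have hFourier : 𝓕 F = 0 := by
    funext x
    rw [Pi.zero_apply, Real.fourier_real_eq_integral_exp_smul]
    have e1 : (fun v : ℝ ↦ Complex.exp (↑(-2 * π * v * x) * I) • F v) =
        (Ici (0 : ℝ)).indicator (fun v : ℝ ↦ Complex.exp (↑(-2 * π * v * x) * I) • G v) := by
      rw [hF, Set.indicator_smul]
    rw [e1, integral_indicator measurableSet_Ici, integral_Ici_eq_integral_Ioi, ← hL (-2 * π * x)]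
    refine setIntegral_congr_fun measurableSet_Ioi fun v _ ↦ ?_
    simp only [hG, smul_eq_mul]
    rw [show Complex.exp (↑(-2 * π * v * x) * I) * (D v * Complex.exp (I * (↑y₀ * I) * ↑v)) =
      D v * (Complex.exp (↑(-2 * π * v * x) * I) * Complex.exp (I * (↑y₀ * I) * ↑v)) by ring,
      ← Complex.exp_add]
    congr 2
    push_cast
    ring
  -- Fourier inversion at `t`
  have hinv := hFint.fourierInv_fourier_eq (by rw [hFourier]; exact integrable_zero _ _ _)
    (hFcont.continuousAt (x := t))
  rw [hFourier] at hinv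
  have hzero : (𝓕⁻ (0 : ℝ → ℂ)) t = 0 := by
    rw [Real.fourierInv_eq']
    simp
  rw [hzero] at hinv
  -- unfold `F t`
  have hFt : F t = D t * Complex.exp (I * ((y₀ : ℂ) * I) * t) := by
    rw [hF, Set.indicator_of_mem (show t ∈ Ici (0 : ℝ) from ht)]
  rw [hFt] at hinv
  rcases mul_eq_zero.1 hinv.symm with h | h
  · exact h
  · exact absurd h (Complex.exp_ne_zero _)

/-! ## Part III. From the Hadamard pairs to the multiset of non-trivial zeros

The Hadamard indices `n` (`bₙ ≠ 0`) list the *pairs* `{ρₙ, 1 − ρₙ}` of non-trivial zeros with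
multiplicity: at a non-trivial zero `ρ` exactly `m(ρ) = riemannZetaZeroOrder ρ` factors vanish
(`IsHadamardSeq.natCast_card_zeroIndices_xiToH`).  Hence a pair sum `∑ₙ [G(ρₙ) + G(1 − ρₙ)]`
regroups as `∑_ρ m(ρ) G(ρ)` over `ZetaZeros.riemannZetaNontrivialZeros` (unconditional sums;
`HasSum.sigma` over the fibres of `J ⊕ J → {zeros}`, `(n, left) ↦ ρₙ`, `(n, right) ↦ 1 − ρₙ`). -/

namespace IsHadamardSeq

variable {b : ℕ → ℂ}

/-- `ρₙ` is a non-trivial zero of `ζ` (`bₙ ≠ 0`). [folklore] -/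
theorem xiZero_mem_nontrivialZeros (h : IsHadamardSeq 0 b) {n : ℕ} (hn : b n ≠ 0) :
    xiZero b n ∈ ZetaZeros.riemannZetaNontrivialZeros :=
  mem_riemannZetaNontrivialZeros_iff_holds.2 (h.riemannZeta_xiZero hn)

/-- `1 − ρₙ` is a non-trivial zero of `ζ` (`bₙ ≠ 0`). [folklore] -/
theorem one_sub_xiZero_mem_nontrivialZeros (h : IsHadamardSeq 0 b) {n : ℕ} (hn : b n ≠ 0) :
    1 - xiZero b n ∈ ZetaZeros.riemannZetaNontrivialZeros :=
  mem_riemannZetaNontrivialZeros_iff_holds.2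
    ((riemannXi_eq_zero_iff_holds _).1 (h.riemannXi_one_sub_xiZero hn))

/-- **Regrouping a pair sum by zeros.** If `∑ₙ 𝟙[bₙ ≠ 0] G(ρₙ) = S` (unconditionally) and
`G(1 − ρ) = G(ρ)`, then `∑_ρ m(ρ) G(ρ) = 2S`, the sum over the non-trivial zeros of `ζ` with
multiplicities `m(ρ) = riemannZetaZeroOrder ρ`. [folklore] -/
theorem hasSum_nontrivialZeros_of_hasSum_pairs (h : IsHadamardSeq 0 b) {G : ℂ → ℂ}
    (hG : ∀ ρ, G (1 - ρ) = G ρ) {S : ℂ}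
    (hS : HasSum (fun n ↦ if b n = 0 then 0 else G (xiZero b n)) S) :
    HasSum (fun ρ : ZetaZeros.riemannZetaNontrivialZeros ↦
      (riemannZetaZeroOrder (ρ : ℂ) : ℂ) * G ρ) (S + S) := by
  classical
  -- Step A: the genuine indices `J`
  have hJ : HasSum (fun n : {n : ℕ // b n ≠ 0} ↦ G (xiZero b n)) S := by
    have hsupp : Function.support (fun n ↦ if b n = 0 then 0 else G (xiZero b n)) ⊆
        {n : ℕ | b n ≠ 0} := by
      intro n hn h0
      exact hn (by simp [h0])
    have h' := (hasSum_subtype_iff_of_support_subset hsupp).2 hS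
    have e : ((fun n ↦ if b n = 0 then 0 else G (xiZero b n)) ∘ (↑) :
        {n : ℕ | b n ≠ 0} → ℂ) = fun n : {n : ℕ // b n ≠ 0} ↦ G (xiZero b n) := by
      funext n
      have hn : b n ≠ 0 := n.2
      simp [hn]
    rw [e] at h'
    exact h'
  -- Step A': the index type `J ⊕ J` (left copy ↦ `ρₙ`, right copy ↦ `1 − ρₙ`)
  set Q : {n : ℕ // b n ≠ 0} ⊕ {n : ℕ // b n ≠ 0} → ℂ :=
    Sum.elim (fun n ↦ G (xiZero b n)) (fun n ↦ G (1 - xiZero b n)) with hQ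
  have hQsum : HasSum Q (S + S) := by
    refine HasSum.sum ?_ ?_
    · have e : Q ∘ Sum.inl = fun n : {n : ℕ // b n ≠ 0} ↦ G (xiZero b n) := by
        funext n; simp [hQ]
      rw [e]; exact hJ
    · have e : Q ∘ Sum.inr = fun n : {n : ℕ // b n ≠ 0} ↦ G (xiZero b n) := by
        funext n; simp [hQ, hG]
      rw [e]; exact hJ
  -- Step B: the map to the zeros
  set P : {n : ℕ // b n ≠ 0} ⊕ {n : ℕ // b n ≠ 0} → ZetaZeros.riemannZetaNontrivialZeros :=
    Sum.elim (fun n ↦ ⟨xiZero b n, h.xiZero_mem_nontrivialZeros n.2⟩)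
      (fun n ↦ ⟨1 - xiZero b n, h.one_sub_xiZero_mem_nontrivialZeros n.2⟩) with hP
  have hQP : ∀ x, Q x = G (P x : ℂ) := by
    rintro (n | n) <;> simp [hQ, hP]
  -- Step C: reindex by the fibres of `P`
  set E := Equiv.sigmaFiberEquiv P with hE_def
  have hE : HasSum (Q ∘ E) (S + S) := E.hasSum_iff.2 hQsum
  refine hE.sigma fun ρ ↦ ?_
  -- Step D: the fibre over `ρ` has `m(ρ)` elements, each contributing `G ρ`
  have hρ0 : riemannXi (ρ : ℂ) = 0 :=
    (riemannXi_eq_zero_iff_holds _).2 (mem_riemannZetaNontrivialZeros_iff_holds.1 ρ.2)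
  set idx : {n : ℕ // b n ≠ 0} ⊕ {n : ℕ // b n ≠ 0} → ℕ :=
    Sum.elim (fun n ↦ n.1) (fun n ↦ n.1) with hidx
  have hval : ∀ x : {x // P x = ρ}, (P x.1 : ℂ) = ρ := fun x ↦ congrArg Subtype.val x.2
  have hmem : ∀ x : {x // P x = ρ}, idx x.1 ∈ h.zeroIndices (xiToH ρ) := by
    intro x
    rw [h.mem_zeroIndices_xiToH_iff]
    obtain ⟨x, hx⟩ := x
    have hx' : (P x : ℂ) = ρ := congrArg Subtype.val hx
    rcases x with n | n
    · exact ⟨n.2, Or.inl (by simpa [hP, hidx] using hx'.symm)⟩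
    · exact ⟨n.2, Or.inr (by simpa [hP, hidx] using hx'.symm)⟩
  set φ : {x // P x = ρ} → (h.zeroIndices (xiToH ρ) : Finset ℕ) := fun x ↦ ⟨idx x.1, hmem x⟩
    with hφ
  have hφbij : Function.Bijective φ := by
    constructor
    · rintro ⟨x, hx⟩ ⟨x', hx'⟩ hxx'
      have hv : idx x = idx x' := congrArg Subtype.val hxx'
      have ex : (P x : ℂ) = ρ := congrArg Subtype.val hx
      have ex' : (P x' : ℂ) = ρ := congrArg Subtype.val hx'
      rcases x with n | n <;> rcases x' with n' | n'
      · have : n = n' := Subtype.ext (by simpa [hidx] using hv)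
        subst this; rfl
      · exfalso
        have hnn : n.1 = n'.1 := by simpa [hidx] using hv
        have e1 : xiZero b n = ρ := by simpa [hP] using ex
        have e2 : 1 - xiZero b n' = ρ := by simpa [hP] using ex'
        have e3 : xiZero b n' = xiZero b n := by simp only [xiZero, hnn]
        have e4 : xiZero b n = 1 - xiZero b n :=
          calc xiZero b n = ρ := e1
            _ = 1 - xiZero b n' := e2.symm
            _ = 1 - xiZero b n := by rw [e3]
        exact h.xiZero_ne_one_sub n.2 e4
      · exfalso
        have hnn : n.1 = n'.1 := by simpa [hidx] using hv
        have e1 : 1 - xiZero b n = ρ := by simpa [hP] using ex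
        have e2 : xiZero b n' = ρ := by simpa [hP] using ex'
        have e3 : xiZero b n' = xiZero b n := by simp only [xiZero, hnn]
        have e4 : xiZero b n = 1 - xiZero b n :=
          calc xiZero b n = xiZero b n' := e3.symm
            _ = ρ := e2
            _ = 1 - xiZero b n := e1.symm
        exact h.xiZero_ne_one_sub n.2 e4
      · have : n = n' := Subtype.ext (by simpa [hidx] using hv)
        subst this; rfl
    · rintro ⟨k, hk⟩
      obtain ⟨hbk, hρk⟩ := h.mem_zeroIndices_xiToH_iff.1 hk
      rcases hρk with e | e
      · exact ⟨⟨Sum.inl ⟨k, hbk⟩, Subtype.ext (by simp [hP, e])⟩, rfl⟩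
      · exact ⟨⟨Sum.inr ⟨k, hbk⟩, Subtype.ext (by simp [hP, e])⟩, rfl⟩
  set eρ := Equiv.ofBijective φ hφbij with heρ
  letI : Fintype {x // P x = ρ} := Fintype.ofEquiv _ eρ.symm
  have hcard : (Fintype.card {x // P x = ρ} : ℂ) = (riemannZetaZeroOrder (ρ : ℂ) : ℂ) := by
    rw [Fintype.card_congr eρ, Fintype.card_coe, ← h.natCast_card_zeroIndices_xiToH hρ0]
    norm_cast
  have hterm : ∀ c : {x // P x = ρ}, (Q ∘ E) ⟨ρ, c⟩ = G ρ := by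
    intro c
    have e1 : E ⟨ρ, c⟩ = c.1 := rfl
    rw [Function.comp_apply, e1, hQP, hval c]
  have hfin := hasSum_fintype (fun c : {x // P x = ρ} ↦ (Q ∘ E) ⟨ρ, c⟩)
  rw [Finset.sum_congr rfl (fun c _ ↦ hterm c), Finset.sum_const, Finset.card_univ, nsmul_eq_mul,
    hcard] at hfin
  exact hfin

/-! ## Part IV. Theorem 1.1 (2) from Theorem 1.1 (1) -/

/-- **`Ψ = Ψ̃`** (Suzuki2023 §2.2): granting Thm 1.1 (1), `Ψ(t) = ∑ₙ 8bₙ(cosh((ρₙ − ½)t) − 1)`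
for every real `t` (for `t ≥ 0` by uniqueness of the Laplace transform, Part II; both sides are
even). [cite: Suzuki2023, Thm 1.1 (2)] -/
theorem zetaScrew_eq_tsum_pairTerm (h : IsHadamardSeq 0 b) (h1 : Suzuki2023_thm11_fourier)
    (t : ℝ) :
    (zetaScrew t : ℂ) = ∑' n, 8 * b n * (Complex.cosh ((xiZero b n - 1 / 2) * t) - 1) := by
  wlog ht : 0 ≤ t generalizing t
  · have h' := this (-t) (by linarith)
    rw [zetaScrew_neg, tsum_pairTerm_neg] at h'
    exact h'
  set D : ℝ → ℂ := fun t ↦ (zetaScrew t : ℂ) -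
    ∑' n, 8 * b n * (Complex.cosh ((xiZero b n - 1 / 2) * t) - 1) with hD
  have him1 : (1 : ℝ) / 2 < (((1 : ℝ) : ℂ) * I).im := by simp; norm_num
  have hcont : ContinuousOn D (Ici 0) :=
    ((Complex.continuous_ofReal.comp continuous_zetaScrew).sub
      h.continuous_tsum_pairTerm).continuousOn
  have hzero : D 0 = 0 := by
    have e : D 0 = (zetaScrew 0 : ℂ) -
        ∑' n, 8 * b n * (Complex.cosh ((xiZero b n - 1 / 2) * ((0 : ℝ) : ℂ)) - 1) := rfl
    rw [e, zetaScrew_zero, tsum_pairTerm_zero]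
    simp
  have hint : IntegrableOn (fun t : ℝ ↦ D t * Complex.exp (I * (((1 : ℝ) : ℂ) * I) * t)) (Ioi 0) := by
    have e : (fun t : ℝ ↦ D t * Complex.exp (I * (((1 : ℝ) : ℂ) * I) * t)) = fun t : ℝ ↦
        (zetaScrew t : ℂ) * Complex.exp (I * (((1 : ℝ) : ℂ) * I) * t) -
          (∑' n, 8 * b n * (Complex.cosh ((xiZero b n - 1 / 2) * t) - 1)) *
            Complex.exp (I * (((1 : ℝ) : ℂ) * I) * t) := by
      funext t; simp only [hD]; ring
    rw [e]
    exact (h1 _ him1).1.sub (h.integrableOn_tsum_pairTerm_mul_exp him1)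
  have hL : ∀ x : ℝ, ∫ t in Ioi (0 : ℝ), D t * Complex.exp (I * ((x : ℂ) + (1 : ℝ) * I) * t) = 0 := by
    intro x
    have him : (1 : ℝ) / 2 < ((x : ℂ) + ((1 : ℝ) : ℂ) * I).im := by simp; norm_num
    exact h.integral_zetaScrew_sub_tsum_pairTerm_mul_exp h1 him
  have hDt := eq_zero_of_laplace_eq_zero hcont hzero hint hL ht
  exact sub_eq_zero.1 hDt

end IsHadamardSeq

/-- **Suzuki2023 Thm 1.1 (2) from Thm 1.1 (1).** Granting the one-sided Fourier transform formula
(1.2) (`Suzuki2023_thm11_fourier`), the series representation (1.3) holds for every real `t`: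
`Ψ(t) = ∑_ρ m(ρ) (cosh((ρ − ½)t) − 1)/(ρ − ½)²`, the sum over the non-trivial zeros of `ζ` with
multiplicity (`= ∑_γ (1 − cos γt)/γ²`, `γ = i(ρ − ½)`).  Proof as in Suzuki2023 §2.2: Hadamard's
factorisation of `ξ` (the tree's `IsHadamardSeq`, `logDeriv_riemannXi_eq_tsum_pairs`), termwise
Laplace transforms, (1.2), uniqueness of the Laplace transform, and the bookkeeping of
multiplicities (`IsHadamardSeq.natCast_card_zeroIndices_xiToH`). [cite: Suzuki2023, Thm 1.1 (2)] -/
theorem Suzuki2023_thm11_series_of_fourier (h1 : Suzuki2023_thm11_fourier) :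
    Suzuki2023_thm11_series := by
  intro t
  obtain ⟨b, hb⟩ := exists_isHadamardSeq 0
  set G : ℂ → ℂ := fun ρ ↦ (Complex.cosh ((ρ - 1 / 2) * t) - 1) / (ρ - 1 / 2) ^ 2 with hG
  have hGsymm : ∀ ρ, G (1 - ρ) = G ρ := by
    intro ρ
    simp only [hG]
    rw [show (1 - ρ - 1 / 2) = -(ρ - 1 / 2) by ring, neg_mul, Complex.cosh_neg, neg_sq]
  have hpair : HasSum (fun n ↦ if b n = 0 then 0 else G (IsHadamardSeq.xiZero b n))
      ((zetaScrew t : ℂ) / 2) := by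
    have hs := (hb.summable_pairTerm t).hasSum
    rw [← hb.zetaScrew_eq_tsum_pairTerm h1 t] at hs
    have e : (fun n ↦ if b n = 0 then 0 else G (IsHadamardSeq.xiZero b n)) =
        fun n ↦ 8 * b n * (Complex.cosh ((IsHadamardSeq.xiZero b n - 1 / 2) * t) - 1) / 2 := by
      funext n
      split_ifs with hn
      · simp [hn]
      · simp only [hG]
        rw [IsHadamardSeq.xiZero_sub_half_sq]
        field_simp
        ring
    rw [e]
    exact hs.div_const 2
  have hsum := hb.hasSum_nontrivialZeros_of_hasSum_pairs hGsymm hpair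
  rw [add_halves] at hsum
  exact hsum

/-! ## Part V. The unconditional discharge -/

/-- **Discharge of `Suzuki2023_thm11_series`** (Suzuki2023 Thm 1.1 (2)), unconditionally: for
every real `t`, `Ψ(t) = ∑_ρ m(ρ) (cosh((ρ − ½)t) − 1)/(ρ − ½)²` over the non-trivial zeros of `ζ`
with multiplicity, absolutely convergent. Thm 1.1 (1) is a theorem of the tree
(`Suzuki2023_thm11_fourier_holds`, `ZetaScrewLaplace.lean`: the Laplace transform of `Ψ` computed
piece by piece as in Suzuki2023 §2.1), and `Suzuki2023_thm11_series_of_fourier` (Part IV) reduces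
(2) to (1) as in Suzuki2023 §2.2. [cite: Suzuki2023, Thm 1.1 (2)] -/
theorem Suzuki2023_thm11_series_holds : Suzuki2023_thm11_series :=
  Suzuki2023_thm11_series_of_fourier Suzuki2023_thm11_fourier_holds

end Literature.NumberTheory.LFunctions
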